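import Literature.Probability.LatticeModels.MedialExplorationPrefixWinding
import Literature.Probability.LatticeModels.MedialCornerWalk
import HarnessLib

/-!
# The winding of the medial exploration at a corner with an ESCAPE PATH is deterministic

Topic `Literature/Probability/LatticeModels`; third instalment after `MedialCornerTrailWinding.lean` (closed
corner trails, signed Umlaufsatz, sign pinned by an extreme dart) and
`MedialExplorationPrefixWinding.lean` (the winding of an exploration prefix closed by a virtual path is read
off the closing path). Here the virtual path is made configuration-free for the medial exploration of
admissible Dobrushin data (`medialExploration`, the cut orbit of the start corner `startCorner hD` up to
the exit time `exitTime hD ω`, `FermionicObservableSums.lean`):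

* `IsEscape D q e M` — an ESCAPE PATH of the corner `q`: corners `e 0 = q, e 1, …, e (M+1)` chained by
  successors and leading back to the start corner `e (M+2) = startCorner hD`, whose darts `e 1, …, e (M+1)`
  are FORBIDDEN to every exploration — each has a non-inner face or its vertex on the dual-wired arc `B`
  (`not_forbidden_cornerOrbit`: before the exit the orbit has inner faces and its left vertex, joined to
  `A` by open edges, is never a `B`-site) — and pairwise distinct;
* `escapeSum e M` — the signed number of quarter turns along `q = e 0 → e 1 → ⋯ → e (M+2)`;
* `IsEscape.isCornerTrail_glue` — for every configuration whose orbit passes `q` at a time `t` before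
  the exit, the orbit prefix glued to the escape path is a closed corner trail extending the first `t`
  exploration steps, with tail sum `escapeSum e M` (`IsEscape.sum_Ico_glue`);
* `IsEscape.of_list` — escape paths from corner LISTS (chained, forbidden tail, no repeats), with
  `escapeSum = walkSign` (`MedialCornerWalk.lean`);
* **`IsEscape.turnCount_eq_of_west_south`** (`+4`) and the four clockwise variants `…_west_north`,
  `…_east_south`, `…_top_east`, `…_bot_west` (`-4`) — if
  moreover some dart of the escape path (or `q`) points south and lies weakly west of every corner with
  an inner face and of the whole escape path, then for EVERY configuration and every passage time `t` of
  `q` before the exit, `turnCount (D.bcBondConfig ω) (startCorner hD) t = 4 - escapeSum e M`: the winding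
  of the exploration at `q` does not depend on the configuration. This is the mechanism behind "the
  winding at a boundary edge is constant" (Duminil-Copin–Hongler–Nolin 2011, Lemma 12; Duminil-Copin–
  Smirnov 2012, Prop. 7.8; Duminil-Copin 2013, Prop. 5): a boundary dart escapes through the boundary.

Everything is proved; no geometry of a specific domain enters.

## References

* H. Duminil-Copin, C. Hongler, P. Nolin, Comm. Pure Appl. Math. 64 (2011), Lemma 12.
  [DuminilCopinHonglerNolin2011]
* S. Smirnov, *Critical percolation in the plane*, C. R. Acad. Sci. Paris 333 (2001), §2 (the
  exploration process). [Smirnov2001]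
-/

namespace Literature.Probability.LatticeModels

open MedialTrail Finset DiscreteDobrushin

variable {D : DiscreteDobrushin}

/-! ### Forbidden darts -/

/-- **Orbit corners before the exit are not forbidden**: they have inner faces, and their vertex is not on
the dual-wired arc `B` (it lies on `A` or on an open edge of the completed configuration, and no open
edge touches `B`). [cite: Smirnov2001, §2] -/
theorem not_forbidden_cornerOrbit (hD : D.IsZdAdmissible) (ω : Percolation.BondConfig (Site 2)) {i : ℕ}
    (hi : i < exitTime hD ω) :
    D.IsInnerFace (cFace (cornerOrbit (D.bcBondConfig ω) (startCorner hD) i)) ∧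
      (cornerOrbit (D.bcBondConfig ω) (startCorner hD) i).1 ∉ D.zdArcB := by
  refine ⟨isInnerFace_of_lt_exitTime hD ω hi, fun hB => ?_⟩
  rcases cornerOrbit_inv (isStartCorner_startCorner hD) (ω := ω) i with hA | ⟨e, he, hxe⟩
  · exact Set.disjoint_left.1 hD.disjoint hA hB
  · exact not_mem_bcBondConfig_of_mem_zdArcB hD hxe hB he

/-- Orbit corners before the exit are pairwise distinct. [cite: Smirnov2001, §2] -/
theorem cornerOrbit_injOn_of_lt_exitTime (hD : D.IsZdAdmissible) (ω : Percolation.BondConfig (Site 2))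
    {i j : ℕ} (hi : i < exitTime hD ω) (hj : j < exitTime hD ω)
    (h : cornerOrbit (D.bcBondConfig ω) (startCorner hD) i = cornerOrbit (D.bcBondConfig ω) (startCorner hD) j) :
    i = j := by
  by_contra hne
  rcases Nat.lt_or_gt_of_ne hne with hlt | hlt
  · exact cornerOrbit_ne hD (isStartCorner_startCorner hD) hlt
      (fun k hk => isInnerFace_of_lt_exitTime hD ω (lt_trans hk hj)) h
  · exact cornerOrbit_ne hD (isStartCorner_startCorner hD) hlt
      (fun k hk => isInnerFace_of_lt_exitTime hD ω (lt_trans hk hi)) h.symm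

/-! ### Escape paths -/

/-- **Escape path of the corner `q`.** Corners `e 0 = q`, `e 1, …, e (M + 1)`, `e (M + 2) = startCorner hD`,
each the left or right successor of the previous one; the darts `e 1, …, e (M + 1)` are forbidden to
explorations (non-inner face, or vertex on the arc `B`) and pairwise distinct. [cite: Smirnov2001, §2] -/
structure IsEscape (D : DiscreteDobrushin) (hD : D.IsZdAdmissible) (q : Site 2 × Fin 4)
    (e : ℕ → Site 2 × Fin 4) (M : ℕ) : Prop where
  /-- The path starts at `q`. -/
  start : e 0 = q
  /-- The path leads back into the start corner. -/
  finish : e (M + 2) = startCorner hD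
  /-- Consecutive corners are chained by successors. -/
  step : ∀ m ≤ M + 1, e (m + 1) = leftSucc (e m) ∨ e (m + 1) = rightSucc (e m)
  /-- The escape darts are forbidden to explorations. -/
  forbidden : ∀ m, 1 ≤ m → m ≤ M + 1 → ¬ D.IsInnerFace (cFace (e m)) ∨ (e m).1 ∈ D.zdArcB
  /-- The escape darts are pairwise distinct. -/
  inj : ∀ i j, 1 ≤ i → i ≤ M + 1 → 1 ≤ j → j ≤ M + 1 → e i = e j → i = j

/-- The signed number of quarter turns along the escape path, junction turns at both ends included:
`∑_{m ≤ M+1} trailSign e m`. [cite: Smirnov2001, §2] -/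
noncomputable def escapeSum (e : ℕ → Site 2 × Fin 4) (M : ℕ) : ℤ := ∑ m ∈ range (M + 2), trailSign e m

/-- The orbit prefix up to time `t` glued to a path `e` starting at the `t`-th orbit corner. [folklore] -/
noncomputable def escGlue (β : Percolation.BondConfig (Site 2)) (c₀ : Site 2 × Fin 4) (t : ℕ)
    (e : ℕ → Site 2 × Fin 4) (i : ℕ) : Site 2 × Fin 4 :=
  if i ≤ t then cornerOrbit β c₀ i else e (i - t)

namespace IsEscape

variable {hD : D.IsZdAdmissible} {q : Site 2 × Fin 4} {e : ℕ → Site 2 × Fin 4} {M : ℕ}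
  {ω : Percolation.BondConfig (Site 2)} {t : ℕ}

/-- The glued sequence on the prefix. [folklore] -/
theorem glue_of_le {β : Percolation.BondConfig (Site 2)} {c₀ : Site 2 × Fin 4} {i : ℕ} (hi : i ≤ t) :
    escGlue β c₀ t e i = cornerOrbit β c₀ i := if_pos hi

/-- The glued sequence on the escape path (including the junction `i = t`, where both descriptions give
`q`). [folklore] -/
theorem glue_add (h : IsEscape D hD q e M) (horb : cornerOrbit (D.bcBondConfig ω) (startCorner hD) t = q)
    (m : ℕ) : escGlue (D.bcBondConfig ω) (startCorner hD) t e (t + m) = e m := by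
  unfold escGlue
  split_ifs with hle
  · obtain rfl : m = 0 := by omega
    rw [Nat.add_zero, horb, h.start]
  · rw [Nat.add_sub_cancel_left]

/-- **The glued sequence is a closed corner trail** of length `t + M + 2`, for every configuration whose
orbit passes `q` at a time `t` before the exit. [cite: Smirnov2001, §2] -/
theorem isCornerTrail_glue (h : IsEscape D hD q e M) (ht : t < exitTime hD ω)
    (horb : cornerOrbit (D.bcBondConfig ω) (startCorner hD) t = q) :
    IsCornerTrail (escGlue (D.bcBondConfig ω) (startCorner hD) t e) (t + M + 2) := by
  set β := D.bcBondConfig ω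
  set c₀ := startCorner hD
  have hglue : ∀ m, escGlue β c₀ t e (t + m) = e m := h.glue_add horb
  refine ⟨by omega, ?_, fun m hm => ?_, fun i j hi hj hij => ?_⟩
  · -- closes up
    rw [show t + M + 2 = t + (M + 2) by omega, hglue, h.finish, glue_of_le (Nat.zero_le _)]
    rfl
  · -- steps
    rcases Nat.lt_or_ge m t with hmt | hmt
    · rw [glue_of_le hmt.le, glue_of_le (Nat.succ_le_of_lt hmt)]
      exact nextCorner_eq_or β _
    · obtain ⟨m', rfl⟩ := Nat.exists_eq_add_of_le hmt
      rw [show t + m' + 1 = t + (m' + 1) by omega, hglue, hglue]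
      exact h.step m' (by omega)
  · -- pairwise distinct
    have forb : ∀ {m}, 1 ≤ m → m ≤ M + 1 → ∀ {i}, i < exitTime hD ω → cornerOrbit β c₀ i ≠ e m := by
      intro m hm1 hm2 i hi heq
      obtain ⟨hinner, hnotB⟩ := not_forbidden_cornerOrbit hD ω hi
      rcases h.forbidden m hm1 hm2 with hni | hB
      · exact hni (heq ▸ hinner)
      · exact hnotB (heq ▸ hB)
    rcases Nat.lt_or_ge t i with hit | hit <;> rcases Nat.lt_or_ge t j with hjt | hjt
    · obtain ⟨i', rfl⟩ := Nat.exists_eq_add_of_lt hit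
      obtain ⟨j', rfl⟩ := Nat.exists_eq_add_of_lt hjt
      rw [show t + i' + 1 = t + (i' + 1) by omega, show t + j' + 1 = t + (j' + 1) by omega, hglue, hglue] at hij
      have := h.inj (i' + 1) (j' + 1) (by omega) (by omega) (by omega) (by omega) hij
      omega
    · obtain ⟨i', rfl⟩ := Nat.exists_eq_add_of_lt hit
      rw [show t + i' + 1 = t + (i' + 1) by omega, hglue, glue_of_le hjt] at hij
      exact absurd hij.symm (forb (by omega) (by omega) (lt_of_le_of_lt hjt ht))
    · obtain ⟨j', rfl⟩ := Nat.exists_eq_add_of_lt hjt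
      rw [show t + j' + 1 = t + (j' + 1) by omega, hglue, glue_of_le hit] at hij
      exact absurd hij (forb (by omega) (by omega) (lt_of_le_of_lt hit ht))
    · rw [glue_of_le hit, glue_of_le hjt] at hij
      exact cornerOrbit_injOn_of_lt_exitTime hD ω (lt_of_le_of_lt hit ht) (lt_of_le_of_lt hjt ht) hij

/-- The glued sequence extends the orbit prefix. [folklore] -/
theorem glue_prefix : ∀ i ≤ t, escGlue (D.bcBondConfig ω) (startCorner hD) t e i =
    cornerOrbit (D.bcBondConfig ω) (startCorner hD) i := fun _ hi => glue_of_le hi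

/-- The tail sum of the glued trail is the escape sum. [folklore] -/
theorem sum_Ico_glue (h : IsEscape D hD q e M) (horb : cornerOrbit (D.bcBondConfig ω) (startCorner hD) t = q) :
    ∑ m ∈ Ico t (t + M + 2), trailSign (escGlue (D.bcBondConfig ω) (startCorner hD) t e) m = escapeSum e M := by
  rw [escapeSum, Finset.sum_Ico_eq_sum_range, show t + M + 2 - t = M + 2 by omega]
  refine Finset.sum_congr rfl fun m _ => ?_
  classical
  unfold trailSign
  rw [show t + m + 1 = t + (m + 1) by omega, h.glue_add horb, h.glue_add horb]

/-- Medial coordinates of the glued trail: every point is an orbit corner before the exit (an inner-face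
corner) or a point of the escape path. [folklore] -/
theorem glue_cases (h : IsEscape D hD q e M) (ht : t < exitTime hD ω)
    (horb : cornerOrbit (D.bcBondConfig ω) (startCorner hD) t = q) {m : ℕ} (hm : m < t + M + 2) :
    (∃ i < exitTime hD ω, escGlue (D.bcBondConfig ω) (startCorner hD) t e m =
        cornerOrbit (D.bcBondConfig ω) (startCorner hD) i) ∨
      ∃ m' ≤ M + 1, escGlue (D.bcBondConfig ω) (startCorner hD) t e m = e m' := by
  rcases Nat.lt_or_ge m t with hmt | hmt
  · exact Or.inl ⟨m, lt_trans hmt ht, glue_of_le hmt.le⟩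
  · obtain ⟨m', rfl⟩ := Nat.exists_eq_add_of_le hmt
    exact Or.inr ⟨m', by omega, h.glue_add horb m'⟩

/-- **Deterministic winding, westmost southward escape dart.** If the escape path of `q` (or `q` itself)
has a southward dart (face index `2`) lying weakly west, in medial coordinates, of every corner with an
inner face and of every point of the escape path, then at every passage of `q` before the exit the turn
count of the exploration is `4 - escapeSum e M`, whatever the configuration.
[cite: DuminilCopinHonglerNolin2011, Lemma 12] -/
theorem turnCount_eq_of_west_south (h : IsEscape D hD q e M) {m₀ : ℕ} (hm₀ : m₀ ≤ M + 1) (h2 : (e m₀).2 = 2)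
    (hwestI : ∀ p : Site 2 × Fin 4, D.IsInnerFace (cFace p) → (cpos (e m₀)).1 ≤ (cpos p).1)
    (hwestE : ∀ m ≤ M + 1, (cpos (e m₀)).1 ≤ (cpos (e m)).1)
    (ω : Percolation.BondConfig (Site 2)) {t : ℕ} (ht : t < exitTime hD ω)
    (horb : cornerOrbit (D.bcBondConfig ω) (startCorner hD) t = q) :
    turnCount (D.bcBondConfig ω) (startCorner hD) t = 4 - escapeSum e M := by
  rw [← h.sum_Ico_glue horb]
  refine _root_.Literature.Probability.LatticeModels.turnCount_eq_of_west_south (h.isCornerTrail_glue ht horb)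
    (by omega) glue_prefix (m₀ := t + m₀) (by omega) (by rw [h.glue_add horb]; exact h2) fun m hm => ?_
  rw [h.glue_add horb]
  rcases h.glue_cases ht horb hm with ⟨i, hi, hgi⟩ | ⟨m', hm', hgm⟩
  · rw [hgi]; exact hwestI _ (isInnerFace_of_lt_exitTime hD ω hi)
  · rw [hgm]; exact hwestE m' hm'

/-- **Deterministic winding, westmost northward escape dart**: turn count `-4 - escapeSum e M`.
[cite: DuminilCopinHonglerNolin2011, Lemma 12] -/
theorem turnCount_eq_of_west_north (h : IsEscape D hD q e M) {m₀ : ℕ} (hm₀ : m₀ ≤ M + 1) (h0 : (e m₀).2 = 0)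
    (hwestI : ∀ p : Site 2 × Fin 4, D.IsInnerFace (cFace p) → (cpos (e m₀)).1 ≤ (cpos p).1)
    (hwestE : ∀ m ≤ M + 1, (cpos (e m₀)).1 ≤ (cpos (e m)).1)
    (ω : Percolation.BondConfig (Site 2)) {t : ℕ} (ht : t < exitTime hD ω)
    (horb : cornerOrbit (D.bcBondConfig ω) (startCorner hD) t = q) :
    turnCount (D.bcBondConfig ω) (startCorner hD) t = -4 - escapeSum e M := by
  rw [← h.sum_Ico_glue horb]
  refine _root_.Literature.Probability.LatticeModels.turnCount_eq_of_west_north (h.isCornerTrail_glue ht horb)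
    (by omega) glue_prefix (m₀ := t + m₀) (by omega) (by rw [h.glue_add horb]; exact h0) fun m hm => ?_
  rw [h.glue_add horb]
  rcases h.glue_cases ht horb hm with ⟨i, hi, hgi⟩ | ⟨m', hm', hgm⟩
  · rw [hgi]; exact hwestI _ (isInnerFace_of_lt_exitTime hD ω hi)
  · rw [hgm]; exact hwestE m' hm'

/-- **Deterministic winding, eastmost southward escape dart**: turn count `-4 - escapeSum e M`.
[cite: DuminilCopinHonglerNolin2011, Lemma 12] -/
theorem turnCount_eq_of_east_south (h : IsEscape D hD q e M) {m₀ : ℕ} (hm₀ : m₀ ≤ M + 1) (h2 : (e m₀).2 = 2)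
    (heastI : ∀ p : Site 2 × Fin 4, D.IsInnerFace (cFace p) → (cpos p).1 ≤ (cpos (e m₀)).1)
    (heastE : ∀ m ≤ M + 1, (cpos (e m)).1 ≤ (cpos (e m₀)).1)
    (ω : Percolation.BondConfig (Site 2)) {t : ℕ} (ht : t < exitTime hD ω)
    (horb : cornerOrbit (D.bcBondConfig ω) (startCorner hD) t = q) :
    turnCount (D.bcBondConfig ω) (startCorner hD) t = -4 - escapeSum e M := by
  rw [← h.sum_Ico_glue horb]
  refine _root_.Literature.Probability.LatticeModels.turnCount_eq_of_east_south (h.isCornerTrail_glue ht horb)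
    (by omega) glue_prefix (m₀ := t + m₀) (by omega) (by rw [h.glue_add horb]; exact h2) fun m hm => ?_
  rw [h.glue_add horb]
  rcases h.glue_cases ht horb hm with ⟨i, hi, hgi⟩ | ⟨m', hm', hgm⟩
  · rw [hgi]; exact heastI _ (isInnerFace_of_lt_exitTime hD ω hi)
  · rw [hgm]; exact heastE m' hm'

/-- **Deterministic winding, topmost eastward escape dart**: turn count `-4 - escapeSum e M`.
[cite: DuminilCopinHonglerNolin2011, Lemma 12] -/
theorem turnCount_eq_of_top_east (h : IsEscape D hD q e M) {m₀ : ℕ} (hm₀ : m₀ ≤ M + 1) (h3 : (e m₀).2 = 3)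
    (htopI : ∀ p : Site 2 × Fin 4, D.IsInnerFace (cFace p) → (cpos p).2 ≤ (cpos (e m₀)).2)
    (htopE : ∀ m ≤ M + 1, (cpos (e m)).2 ≤ (cpos (e m₀)).2)
    (ω : Percolation.BondConfig (Site 2)) {t : ℕ} (ht : t < exitTime hD ω)
    (horb : cornerOrbit (D.bcBondConfig ω) (startCorner hD) t = q) :
    turnCount (D.bcBondConfig ω) (startCorner hD) t = -4 - escapeSum e M := by
  rw [← h.sum_Ico_glue horb]
  refine _root_.Literature.Probability.LatticeModels.turnCount_eq_of_top_east (h.isCornerTrail_glue ht horb)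
    (by omega) glue_prefix (m₀ := t + m₀) (by omega) (by rw [h.glue_add horb]; exact h3) fun m hm => ?_
  rw [h.glue_add horb]
  rcases h.glue_cases ht horb hm with ⟨i, hi, hgi⟩ | ⟨m', hm', hgm⟩
  · rw [hgi]; exact htopI _ (isInnerFace_of_lt_exitTime hD ω hi)
  · rw [hgm]; exact htopE m' hm'

/-- **Deterministic winding, bottommost westward escape dart**: turn count `-4 - escapeSum e M`.
[cite: DuminilCopinHonglerNolin2011, Lemma 12] -/
theorem turnCount_eq_of_bot_west (h : IsEscape D hD q e M) {m₀ : ℕ} (hm₀ : m₀ ≤ M + 1) (h1 : (e m₀).2 = 1)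
    (hbotI : ∀ p : Site 2 × Fin 4, D.IsInnerFace (cFace p) → (cpos (e m₀)).2 ≤ (cpos p).2)
    (hbotE : ∀ m ≤ M + 1, (cpos (e m₀)).2 ≤ (cpos (e m)).2)
    (ω : Percolation.BondConfig (Site 2)) {t : ℕ} (ht : t < exitTime hD ω)
    (horb : cornerOrbit (D.bcBondConfig ω) (startCorner hD) t = q) :
    turnCount (D.bcBondConfig ω) (startCorner hD) t = -4 - escapeSum e M := by
  rw [← h.sum_Ico_glue horb]
  refine _root_.Literature.Probability.LatticeModels.turnCount_eq_of_bot_west (h.isCornerTrail_glue ht horb)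
    (by omega) glue_prefix (m₀ := t + m₀) (by omega) (by rw [h.glue_add horb]; exact h1) fun m hm => ?_
  rw [h.glue_add horb]
  rcases h.glue_cases ht horb hm with ⟨i, hi, hgi⟩ | ⟨m', hm', hgm⟩
  · rw [hgi]; exact hbotI _ (isInnerFace_of_lt_exitTime hD ω hi)
  · rw [hgm]; exact hbotE m' hm'

end IsEscape

/-! ### Escape paths from corner lists -/

section OfList

variable {hD : D.IsZdAdmissible} {q : Site 2 × Fin 4}

/-- The sum of trail signs of a `getD`-sequence of a list, continued by the default, is its `walkSign`.
[folklore] -/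
theorem sum_trailSign_getD : ∀ (L : List (Site 2 × Fin 4)) (c : Site 2 × Fin 4),
    ∑ m ∈ range L.length, trailSign (fun i => L.getD i c) m = walkSign L c
  | [], c => by simp [walkSign]
  | [a], c => by
    classical
    simp [walkSign, trailSign, sgn]
  | a :: b :: rest, c => by
    have ih := sum_trailSign_getD (b :: rest) c
    rw [walkSign, ← ih, List.length_cons, Finset.sum_range_succ', add_comm]
    congr 1

/-- **Escape paths from corner lists.** A list `L = [q, e₁, …, e_{M+1}]` of corners chained by successors,
whose last corner has the start corner as a successor, whose tail is forbidden to explorations and which has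
no repeated corner, is an escape path of `q` (as the sequence `i ↦ L.getD i (startCorner hD)`), with escape
sum `walkSign L (startCorner hD)`. [cite: Smirnov2001, §2] -/
theorem IsEscape.of_list (L : List (Site 2 × Fin 4)) {M : ℕ} (hlen : L.length = M + 2) (hq : L.head? = some q)
    (hchain : L.IsChain IsSucc)
    (hlast : IsSucc (L.getLast (List.ne_nil_of_length_eq_add_one hlen)) (startCorner hD))
    (hforb : ∀ d ∈ L.tail, ¬ D.IsInnerFace (cFace d) ∨ d.1 ∈ D.zdArcB) (hnodup : L.Nodup) :
    IsEscape D hD q (fun i => L.getD i (startCorner hD)) M ∧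
      escapeSum (fun i => L.getD i (startCorner hD)) M = walkSign L (startCorner hD) := by
  have hne : L ≠ [] := List.ne_nil_of_length_eq_add_one hlen
  refine ⟨⟨?_, ?_, fun m hm => ?_, fun m hm1 hm2 => ?_, fun i j hi1 hi2 hj1 hj2 hij => ?_⟩, ?_⟩
  · rw [List.getD_eq_getElem _ _ (by omega)]
    rw [List.head?_eq_getElem?, List.getElem?_eq_getElem (by omega), Option.some.injEq] at hq
    exact hq
  · exact List.getD_eq_default _ _ (by omega)
  · rcases Nat.lt_or_ge (m + 1) L.length with h | h
    · rw [List.getD_eq_getElem _ _ h, List.getD_eq_getElem _ _ (by omega)]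
      exact hchain.getElem m h
    · have hm' : m = M + 1 := by omega
      subst hm'
      rw [List.getD_eq_default _ _ (by omega), List.getD_eq_getElem _ _ (by omega)]
      have hL : L[M + 1] = L.getLast hne := by
        rw [List.getLast_eq_getElem hne]; congr 1; omega
      rw [hL]; exact hlast
  · rw [List.getD_eq_getElem _ _ (by omega)]
    refine hforb _ ?_
    rw [List.mem_iff_getElem]
    refine ⟨m - 1, by rw [List.length_tail]; omega, ?_⟩
    rw [List.getElem_tail]
    congr 1; omega
  · change L.getD i _ = L.getD j _ at hij
    rw [List.getD_eq_getElem _ _ (by omega), List.getD_eq_getElem _ _ (by omega)] at hij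
    exact (hnodup.getElem_inj_iff).1 hij
  · rw [escapeSum, ← hlen]
    exact sum_trailSign_getD L _

end OfList

end Literature.Probability.LatticeModels
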